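import Summits.ResolutionOfSingularities.ResolutionOfSingularities.Theorems.HilbertSamuelEliminationCampaignW42ConePointThickening
import HarnessLib

/-!
# [OURS · L1 W4.2] The thickening of `O_{C,𝔓}` modulo the regular local ring `S_𝔓` IS the local ring of the base-changed cone
# `C_L` at its `L`-rational point `x̄` (`L = κ(𝔓)`): `B/𝔓(Y)B ≅ (L[X]/I_L)_{𝔪_{x̄}}`, with `𝔓(Y)B` generated by
# `n − dim S/𝔓` elements (campaign s42, cell res-hironaka; informal crux `RidgeConfinement`, stmt-ResolutionOfSingularities-17845;
# `--supports`; brick B4′ of the unconditional `RidgeDimMonotone`)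

HONEST FRAMING. OURS (slot W4.2, prover res-L1-s42-pv-1, gen 5). Sequel of `…CampaignW42ConePointThickening` (same setting:
`S = K[X]`, `I ⊆ 𝔓`, `T = S/I`, `D = S/𝔓`, `L = Frac D`, `B = (T[Y])_𝔔`, `𝔔 = ker(T[Y] → L)`). The SECOND structure of the
thickening: the regular local ring `R = S_𝔓` (a localization of a polynomial ring over a field; `dim R = ht 𝔓 = n − dim S/𝔓`) maps
to `B` through the polynomial variables (`S = K[Y] → T[Y]`, `𝔔 ∩ S = 𝔓`), and

* `nonempty_ringEquiv_thickening_mod_regular` — **`B/𝔪_R B ≅ (L[X]/I_L)_{𝔪_{x̄}}`**, the local ring of the cone `C_L = C ×_K L`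
  at its `L`-rational point `x̄` (the «swap» `T[Y]/𝔓(Y) ≅ D[X]/I(X)`, then fractions of `D` are units at `x̄`);
* `exists_span_eq_map_maximalIdeal_regularSide` — `𝔪_R B` is generated by `h` elements with `h + dim S/𝔓 = n`.

With `…ConePointThickening` (`H⁽⁰⁾(B) = H⁽ⁿ⁾(O_{C,𝔓})`, `dim F(B) = dim F(O_{C,𝔓}) + n`) and the hypersurface-section bricks this
yields Dietel's (8.2.6) `H⁽¹⁾(O_{C_L,x̄}) ≥ H⁽ᵈ⁺¹⁾(O_{C,𝔓})`, and in the equality case `dim F(O_{C_L,x̄}) ≥ dim F(O_{C,𝔓}) + d`, with NO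
transcendence bases and NO tower of simple extensions (sequel `…CampaignW42ConeRidgeDimPrime`). NOTHING here is a statement of
H. Hironaka's manuscript [Hironaka2017]. AI review is weaker than expert review. References (orientation only): B. Dietel,
Dissertation Regensburg (2015), (8.2.3)–(8.2.6); V. Cossart, U. Jannsen, S. Saito, LNM 2270 (2020), proof of Thm. 3.10 (p. 47).
-/

noncomputable section

-- single-conjunct summit: the doubled namespace component `ResolutionOfSingularities` is mandated
set_option linter.dupNamespace false
-- localizations of polynomial rings over quotient rings: nested instance problems (as in the gen-3/4 files)
set_option maxSynthPendingDepth 3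

open IsLocalRing MvPolynomial Module
open Literature.RingTheory.HilbertSamuel Literature.RingTheory.MvPolynomial
open Literature.AlgebraicGeometry.Resolution

attribute [local instance] MvPolynomial.algebraMvPolynomial

namespace Summit.ResolutionOfSingularities.ResolutionOfSingularities.Theorems

namespace CampaignW42

universe u

variable {K : Type u} [Field K] {n : ℕ} {I 𝔓 : Ideal (MvPolynomial (Fin n) K)} (hI𝔓 : I ≤ 𝔓)
  (L : Type u) [Field L] [Algebra (MvPolynomial (Fin n) K ⧸ 𝔓) L]

/-- [notation] `T = S/I`, the coordinate ring of the cone. -/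
local notation3 "T" => MvPolynomial (Fin n) K ⧸ I
/-- [notation] `D = S/𝔓`. -/
local notation3 "D" => MvPolynomial (Fin n) K ⧸ 𝔓
/-- [notation] `x̄ ∈ Lⁿ`, the images of the variables. -/
local notation3 "xbar" => fun i : Fin n => algebraMap (MvPolynomial (Fin n) K ⧸ 𝔓) L (Ideal.Quotient.mk 𝔓 (X i))
/-- [notation] `ψ : T[Y] → L`. -/
local notation3 "ψ" => eval₂Hom ((algebraMap (MvPolynomial (Fin n) K ⧸ 𝔓) L).comp (Ideal.Quotient.factor hI𝔓)) xbar
/-- [notation] `I_D = I · D[X]`. -/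
local notation3 "ID" => I.map (MvPolynomial.map (algebraMap K (MvPolynomial (Fin n) K ⧸ 𝔓)))
/-- [notation] `ι₂ : S = K[Y] → T[Y]`, polynomials with constant coefficients. -/
local notation3 "ι₂" => MvPolynomial.map (σ := Fin n) (algebraMap K (MvPolynomial (Fin n) K ⧸ I))
/-- [notation] `E₂ = 𝔓(Y) · T[Y]`. -/
local notation3 "E₂" => 𝔓.map ι₂

/-! ## The swap `T[Y]/𝔓(Y) ≅ D[X]/I(X)` -/

section Swap

/-- `I ⊆ ker(S → D[X]/I_D)` (the coefficient map of the swap kills `I`). [folklore] -/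
theorem le_ker_mk_comp_map :
    I ≤ RingHom.ker ((Ideal.Quotient.mk ID).comp (MvPolynomial.map (algebraMap K D))) := fun q hq => by
  rw [RingHom.mem_ker, RingHom.comp_apply, Ideal.Quotient.eq_zero_iff_mem]
  exact Ideal.mem_map_of_mem _ hq

/-- The forward swap map `T[Y] → D[X]/I_D`: coefficients `T = S/I → D[X]/I_D` (`X ↦ X`), variables `Y_i ↦ x̄_i ∈ D`.
[folklore] -/
theorem swapFwd_wd : E₂ ≤ RingHom.ker (eval₂Hom (Ideal.Quotient.lift I ((Ideal.Quotient.mk ID).comp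
      (MvPolynomial.map (algebraMap K D))) (fun _ hq => le_ker_mk_comp_map hq))
      (fun i => Ideal.Quotient.mk ID (C (Ideal.Quotient.mk 𝔓 (X i))))) := by
  rw [Ideal.map_le_iff_le_comap]
  intro p hp
  rw [Ideal.mem_comap, RingHom.mem_ker, eval₂Hom_map_hom]
  -- `p ↦ C̄(p̄)` where `p̄ ∈ D` is the class of `p`, which is `0`
  have key : ∀ q : MvPolynomial (Fin n) K,
      eval₂Hom ((Ideal.Quotient.lift I ((Ideal.Quotient.mk ID).comp (MvPolynomial.map (algebraMap K D)))
          (fun _ hq => le_ker_mk_comp_map hq)).comp (algebraMap K T))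
        (fun i => Ideal.Quotient.mk ID (C (Ideal.Quotient.mk 𝔓 (X i)))) q =
      Ideal.Quotient.mk ID (C (Ideal.Quotient.mk 𝔓 q)) := fun q => by
    induction q using MvPolynomial.induction_on with
    | C c =>
      rw [coe_eval₂Hom, eval₂_C, RingHom.comp_apply, IsScalarTower.algebraMap_apply K (MvPolynomial (Fin n) K) T,
        Ideal.Quotient.algebraMap_eq, Ideal.Quotient.lift_mk, RingHom.comp_apply, MvPolynomial.algebraMap_eq, map_C,
        IsScalarTower.algebraMap_apply K (MvPolynomial (Fin n) K) D, Ideal.Quotient.algebraMap_eq, MvPolynomial.algebraMap_eq]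
    | add p q hp hq => rw [map_add, hp, hq, map_add, map_add, map_add]
    | mul_X p i hp => rw [map_mul, hp, coe_eval₂Hom, eval₂_X, map_mul, map_mul, map_mul]
  rw [key, Ideal.Quotient.eq_zero_iff_mem.mpr hp, map_zero, map_zero]

end Swap

/-- The evaluation of `q ∈ S` at the tautological point of `D = S/𝔓`, pushed along `τ : D → L'`, is `τ(q̄)`. [folklore] -/
theorem eval₂Hom_tautological {L' : Type*} [CommRing L'] (τ : D →+* L') (q : MvPolynomial (Fin n) K) :
    eval₂Hom (τ.comp (algebraMap K D)) (fun i => τ (Ideal.Quotient.mk 𝔓 (X i))) q = τ (Ideal.Quotient.mk 𝔓 q) := by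
  induction q using MvPolynomial.induction_on with
  | C c => rw [coe_eval₂Hom, eval₂_C, RingHom.comp_apply]; rfl
  | add p q hp hq => rw [map_add, hp, hq, map_add, map_add]
  | mul_X p i hp => rw [map_mul, hp, coe_eval₂Hom, eval₂_X, map_mul, map_mul]

/-- `𝔓 ⊆ ker(S → T[Y]/E₂)`. [folklore] -/
theorem le_ker_mk_comp_ι₂ : 𝔓 ≤ RingHom.ker ((Ideal.Quotient.mk E₂).comp ι₂) := fun p hp => by
  rw [RingHom.mem_ker, RingHom.comp_apply, Ideal.Quotient.eq_zero_iff_mem]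
  exact Ideal.mem_map_of_mem _ hp

/-- [notation] the forward swap map `f₁ : T[Y] → D[X]/I_D`. -/
local notation3 "f₁" => eval₂Hom (Ideal.Quotient.lift I ((Ideal.Quotient.mk ID).comp
    (MvPolynomial.map (algebraMap K D))) (fun _ hq => le_ker_mk_comp_map hq))
    (fun i => Ideal.Quotient.mk ID (C (Ideal.Quotient.mk 𝔓 (X i))))
/-- [notation] the backward swap map `f₂ : D[X] → T[Y]/E₂`. -/
local notation3 "f₂" => eval₂Hom (Ideal.Quotient.lift 𝔓 ((Ideal.Quotient.mk E₂).comp ι₂) (fun _ hp => le_ker_mk_comp_ι₂ hp))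
    (fun i => Ideal.Quotient.mk E₂ (C (Ideal.Quotient.mk I (X i))))

/-- `f₁` on a polynomial with constant coefficients: `f₁(ι₂ s) = C̄(s̄)`. [folklore] -/
theorem swapFwd_ι₂ (s : MvPolynomial (Fin n) K) : f₁ (ι₂ s) = Ideal.Quotient.mk ID (C (Ideal.Quotient.mk 𝔓 s)) := by
  rw [eval₂Hom_map_hom]
  have hτ : (Ideal.Quotient.lift I ((Ideal.Quotient.mk ID).comp (MvPolynomial.map (algebraMap K D)))
      (fun _ hq => le_ker_mk_comp_map hq)).comp (algebraMap K T) =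
      (((Ideal.Quotient.mk ID).comp C).comp (algebraMap K D)) := by
    ext c
    simp only [RingHom.comp_apply]
    rw [IsScalarTower.algebraMap_apply K (MvPolynomial (Fin n) K) T, Ideal.Quotient.algebraMap_eq, Ideal.Quotient.lift_mk,
      RingHom.comp_apply, MvPolynomial.algebraMap_eq, map_C, IsScalarTower.algebraMap_apply K (MvPolynomial (Fin n) K) D,
      Ideal.Quotient.algebraMap_eq, MvPolynomial.algebraMap_eq]
  rw [hτ]
  exact eval₂Hom_tautological ((Ideal.Quotient.mk ID).comp C) s

/-- `f₂` on a polynomial with constant coefficients: `f₂(q(X)) = C̄(q̄)`. [folklore] -/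
theorem swapBwd_map (q : MvPolynomial (Fin n) K) :
    f₂ (MvPolynomial.map (algebraMap K D) q) = Ideal.Quotient.mk E₂ (C (Ideal.Quotient.mk I q)) := by
  rw [eval₂Hom_map_hom]
  have hτ : (Ideal.Quotient.lift 𝔓 ((Ideal.Quotient.mk E₂).comp ι₂) (fun _ hp => le_ker_mk_comp_ι₂ hp)).comp (algebraMap K D) =
      ((Ideal.Quotient.mk E₂).comp (C.comp (Ideal.Quotient.mk I))).comp C := by
    ext c
    simp only [RingHom.comp_apply]
    rw [IsScalarTower.algebraMap_apply K (MvPolynomial (Fin n) K) D, Ideal.Quotient.algebraMap_eq, Ideal.Quotient.lift_mk,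
      RingHom.comp_apply, MvPolynomial.algebraMap_eq, map_C, IsScalarTower.algebraMap_apply K (MvPolynomial (Fin n) K) T,
      Ideal.Quotient.algebraMap_eq, MvPolynomial.algebraMap_eq]
  rw [hτ]
  change eval₂ ((((Ideal.Quotient.mk E₂).comp (C.comp (Ideal.Quotient.mk I))).comp C)) _ q = _
  induction q using MvPolynomial.induction_on with
  | C c => rw [eval₂_C]; rfl
  | add p q hp hq => rw [eval₂_add, hp, hq, map_add, map_add, map_add]
  | mul_X p i hp => rw [eval₂_mul, eval₂_X, hp, map_mul, map_mul, map_mul]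

/-- `I_D ⊆ ker f₂`. [folklore] -/
theorem swapBwd_wd : ID ≤ RingHom.ker f₂ := by
  rw [Ideal.map_le_iff_le_comap]
  intro q hq
  rw [Ideal.mem_comap, RingHom.mem_ker, swapBwd_map, Ideal.Quotient.eq_zero_iff_mem.mpr hq, map_zero, map_zero]

/-- **The swap isomorphism `T[Y]/𝔓(Y) ≅ D[X]/I·D[X]`** («`K[X,Y]/(I(X) + 𝔓(Y))` computed in the two orders»), recorded by its
composite with `T[Y] → T[Y]/E₂` (which is `f₁`). [folklore] -/
theorem exists_swapEquiv :
    ∃ e : (MvPolynomial (Fin n) T ⧸ E₂) ≃+* (MvPolynomial (Fin n) D ⧸ ID), e.toRingHom.comp (Ideal.Quotient.mk E₂) = f₁ := by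
  let Θ₁ : (MvPolynomial (Fin n) T ⧸ E₂) →+* (MvPolynomial (Fin n) D ⧸ ID) :=
    Ideal.Quotient.lift E₂ f₁ (fun _ hp => swapFwd_wd hp)
  let Θ₂ : (MvPolynomial (Fin n) D ⧸ ID) →+* (MvPolynomial (Fin n) T ⧸ E₂) :=
    Ideal.Quotient.lift ID f₂ (fun _ hp => swapBwd_wd hp)
  have h21 : Θ₂.comp Θ₁ = RingHom.id _ := by
    refine Ideal.Quotient.ringHom_ext (ringHom_ext (fun t => ?_) (fun i => ?_))
    · obtain ⟨s, rfl⟩ := Ideal.Quotient.mk_surjective t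
      rw [RingHom.comp_apply, RingHom.comp_apply, RingHom.id_comp]
      change Θ₂ (f₁ (C (Ideal.Quotient.mk I s))) = _
      rw [coe_eval₂Hom, eval₂_C, Ideal.Quotient.lift_mk, RingHom.comp_apply]
      change f₂ (MvPolynomial.map (algebraMap K D) s) = _
      rw [swapBwd_map]
    · rw [RingHom.comp_apply, RingHom.comp_apply, RingHom.id_comp]
      change Θ₂ (f₁ (X i)) = _
      rw [coe_eval₂Hom, eval₂_X]
      change f₂ (C (Ideal.Quotient.mk 𝔓 (X i))) = _
      rw [coe_eval₂Hom, eval₂_C, Ideal.Quotient.lift_mk, RingHom.comp_apply, map_X]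
  have h12 : Θ₁.comp Θ₂ = RingHom.id _ := by
    refine Ideal.Quotient.ringHom_ext (ringHom_ext (fun t => ?_) (fun i => ?_))
    · obtain ⟨s, rfl⟩ := Ideal.Quotient.mk_surjective t
      rw [RingHom.comp_apply, RingHom.comp_apply, RingHom.id_comp]
      change Θ₁ (f₂ (C (Ideal.Quotient.mk 𝔓 s))) = _
      rw [coe_eval₂Hom, eval₂_C, Ideal.Quotient.lift_mk, RingHom.comp_apply]
      change f₁ (ι₂ s) = _
      rw [swapFwd_ι₂]
    · rw [RingHom.comp_apply, RingHom.comp_apply, RingHom.id_comp]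
      change Θ₁ (f₂ (X i)) = _
      rw [coe_eval₂Hom, eval₂_X]
      change f₁ (C (Ideal.Quotient.mk I (X i))) = _
      rw [coe_eval₂Hom, eval₂_C, Ideal.Quotient.lift_mk, RingHom.comp_apply, map_X]
  exact ⟨RingEquiv.ofRingHom Θ₁ Θ₂ h12 h21, rfl⟩

/-! ## The point `x̄` read on both sides -/

include hI𝔓 in
/-- `I_D ⊆ 𝔔_D = ker(D[X] → L)` (`I ⊆ 𝔓`). [folklore] -/
theorem map_le_ker_eval₂Hom : ID ≤ RingHom.ker (eval₂Hom (algebraMap D L) xbar) := by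
  rw [Ideal.map_le_iff_le_comap]
  intro q hq
  rw [Ideal.mem_comap, RingHom.mem_ker, eval₂Hom_map_hom]
  change eval₂Hom ((algebraMap D L).comp (algebraMap K D)) (fun i => algebraMap D L (Ideal.Quotient.mk 𝔓 (X i))) q = 0
  rw [eval₂Hom_tautological, Ideal.Quotient.eq_zero_iff_mem.mpr (hI𝔓 hq), map_zero]

/-- `(D[X]/I_D → L) ∘ f₁ = ψ`: the swap carries the point `𝔔` of `T[Y]` to the point `x̄` of `D[X]/I_D`. [folklore] -/
theorem lift_eval₂Hom_comp_swapFwd :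
    (Ideal.Quotient.lift ID (eval₂Hom (algebraMap D L) xbar) (fun _ hq => map_le_ker_eval₂Hom hI𝔓 L hq)).comp f₁ = ψ := by
  refine ringHom_ext (fun t => ?_) (fun i => ?_)
  · obtain ⟨s, rfl⟩ := Ideal.Quotient.mk_surjective t
    have h1 : ψ (C (Ideal.Quotient.mk I s)) = algebraMap D L (Ideal.Quotient.mk 𝔓 s) := by
      rw [coe_eval₂Hom, eval₂_C, RingHom.comp_apply, Ideal.Quotient.factor_mk]
    have h2 : f₁ (C (Ideal.Quotient.mk I s)) = Ideal.Quotient.mk ID (MvPolynomial.map (algebraMap K D) s) := by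
      rw [coe_eval₂Hom, eval₂_C, Ideal.Quotient.lift_mk, RingHom.comp_apply]
    rw [RingHom.comp_apply, h2, Ideal.Quotient.lift_mk, eval₂Hom_map_hom, h1]
    exact eval₂Hom_tautological (algebraMap D L) s
  · rw [RingHom.comp_apply, coe_eval₂Hom, eval₂_X, Ideal.Quotient.lift_mk, coe_eval₂Hom, eval₂_C, coe_eval₂Hom, eval₂_X]

section Structure

variable [IsFractionRing (MvPolynomial (Fin n) K ⧸ 𝔓) L]
  {Q : Ideal (MvPolynomial (Fin n) (MvPolynomial (Fin n) K ⧸ I))} [Q.IsPrime]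
  (hQ : Q = RingHom.ker (eval₂Hom ((algebraMap (MvPolynomial (Fin n) K ⧸ 𝔓) L).comp (Ideal.Quotient.factor hI𝔓))
    (fun i : Fin n => algebraMap (MvPolynomial (Fin n) K ⧸ 𝔓) L (Ideal.Quotient.mk 𝔓 (X i)))))

/-- [notation] the thickening `B = (T[Y])_𝔔`. -/
local notation3 "B" => Localization.AtPrime Q

omit [Q.IsPrime] in
include hQ in
/-- `E₂ ⊆ 𝔔`. [folklore] -/
theorem map_ι₂_le_thickeningPrime : E₂ ≤ Q := by
  rw [hQ, Ideal.map_le_iff_le_comap, ker_conePointMap_comap_map hI𝔓 L]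

include hQ in
/-- **`B/E₂B ≅ (L[X]/I_L)_{𝔪_{x̄}}`**, `I_L = I_D · L[X]`: `B/E₂B` is the localization of `T[Y]/E₂ ≅ D[X]/I_D` at the point
`x̄`, and `L[X]/I_L` is the localization of `D[X]/I_D` at the fractions of `D`, which are units at `x̄`.
[cite: Dietel2015, (8.2.3), (8.2.6.2)] -/
theorem nonempty_ringEquiv_thickening_mod_regular
    [hQL : ((RingHom.ker (eval xbar) : Ideal (MvPolynomial (Fin n) L)).map (Ideal.Quotient.mk
      ((ID).map (algebraMap (MvPolynomial (Fin n) D) (MvPolynomial (Fin n) L))))).IsPrime] :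
    Nonempty ((B ⧸ (E₂).map (algebraMap (MvPolynomial (Fin n) T) B)) ≃+*
      Localization.AtPrime ((RingHom.ker (eval xbar) : Ideal (MvPolynomial (Fin n) L)).map (Ideal.Quotient.mk
        ((ID).map (algebraMap (MvPolynomial (Fin n) D) (MvPolynomial (Fin n) L)))))) := by
  obtain ⟨e, he⟩ := exists_swapEquiv (K := K) (n := n) (I := I) (𝔓 := 𝔓)
  set IL := (ID).map (algebraMap (MvPolynomial (Fin n) D) (MvPolynomial (Fin n) L)) with hIL
  set QL : Ideal (MvPolynomial (Fin n) L ⧸ IL) :=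
    (RingHom.ker (eval xbar) : Ideal (MvPolynomial (Fin n) L)).map (Ideal.Quotient.mk IL) with hQLdef
  set Lv := Localization.AtPrime QL
  -- the point `x̄` on `W = D[X]/I_D`
  set QW : Ideal (MvPolynomial (Fin n) D ⧸ ID) :=
    (RingHom.ker (eval₂Hom (algebraMap D L) xbar)).map (Ideal.Quotient.mk ID) with hQW
  have hQWker : QW = RingHom.ker (Ideal.Quotient.lift ID (eval₂Hom (algebraMap D L) xbar)
      (fun _ hq => map_le_ker_eval₂Hom hI𝔓 L hq)) := by
    rw [hQW, Ideal.ker_quotient_lift]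
  haveI hQWp : QW.IsPrime := by rw [hQWker]; exact RingHom.ker_isPrime _
  -- `L[X]/I_L` is the localization of `W` at the fractions of `D`; `Lv` is the localization of `W` at `QW`
  haveI : IsLocalization ((nonZeroDivisors D).map (C : D →+* MvPolynomial (Fin n) D)) (MvPolynomial (Fin n) L) :=
    MvPolynomial.isLocalization _ _
  haveI hWloc : IsLocalization (Algebra.algebraMapSubmonoid (MvPolynomial (Fin n) D ⧸ ID)
      ((nonZeroDivisors D).map (C : D →+* MvPolynomial (Fin n) D))) (MvPolynomial (Fin n) L ⧸ IL) := inferInstance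
  haveI hLv : IsLocalization.AtPrime Lv (QL.comap (algebraMap (MvPolynomial (Fin n) D ⧸ ID) (MvPolynomial (Fin n) L ⧸ IL))) :=
    IsLocalization.isLocalization_isLocalization_atPrime_isLocalization
      (Algebra.algebraMapSubmonoid (MvPolynomial (Fin n) D ⧸ ID) ((nonZeroDivisors D).map (C : D →+* MvPolynomial (Fin n) D)))
      Lv QL
  have hQLW : QL.comap (algebraMap (MvPolynomial (Fin n) D ⧸ ID) (MvPolynomial (Fin n) L ⧸ IL)) = QW := by
    refine Ideal.comap_injective_of_surjective (Ideal.Quotient.mk ID) Ideal.Quotient.mk_surjective ?_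
    have hcomp : (algebraMap (MvPolynomial (Fin n) D ⧸ ID) (MvPolynomial (Fin n) L ⧸ IL)).comp (Ideal.Quotient.mk ID) =
        (Ideal.Quotient.mk IL).comp (algebraMap (MvPolynomial (Fin n) D) (MvPolynomial (Fin n) L)) := by
      refine RingHom.ext fun p => ?_
      rfl
    rw [Ideal.comap_comap, hcomp, ← Ideal.comap_comap, hQLdef, Ideal.comap_map_of_surjective _ Ideal.Quotient.mk_surjective,
      ← RingHom.ker_eq_comap_bot, Ideal.mk_ker, hQW, Ideal.comap_map_of_surjective _ Ideal.Quotient.mk_surjective,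
      ← RingHom.ker_eq_comap_bot, Ideal.mk_ker, sup_eq_left.mpr (map_le_ker_eval₂Hom hI𝔓 L), ker_eval₂Hom_eq_comap_ker_eval L]
    have hILle : IL ≤ RingHom.ker (eval xbar) := by
      rw [hIL, Ideal.map_le_iff_le_comap, ← ker_eval₂Hom_eq_comap_ker_eval L]
      exact map_le_ker_eval₂Hom hI𝔓 L
    rw [sup_eq_left.mpr hILle]
  -- `B/E₂B` is the localization of `T[Y]/E₂` at `𝔔/E₂`
  haveI hE := isPrime_map_quotientMk_of_le (map_ι₂_le_thickeningPrime hI𝔓 L hQ)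
  haveI hBloc : IsLocalization.AtPrime (B ⧸ (E₂).map (algebraMap (MvPolynomial (Fin n) T) B))
      (Q.map (Ideal.Quotient.mk E₂)) :=
    isLocalization_atPrime_quotient_mapExt_of_le (map_ι₂_le_thickeningPrime hI𝔓 L hQ) B
  -- transport `Lv`'s structure along the swap `e`
  have hQ' : Q.map (Ideal.Quotient.mk E₂) =
      (QL.comap (algebraMap (MvPolynomial (Fin n) D ⧸ ID) (MvPolynomial (Fin n) L ⧸ IL))).comap e.toRingHom := by
    rw [hQLW]
    refine Ideal.comap_injective_of_surjective (Ideal.Quotient.mk E₂) Ideal.Quotient.mk_surjective ?_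
    rw [Ideal.comap_map_of_surjective _ Ideal.Quotient.mk_surjective, ← RingHom.ker_eq_comap_bot, Ideal.mk_ker,
      sup_eq_left.mpr (map_ι₂_le_thickeningPrime hI𝔓 L hQ), Ideal.comap_comap, he, hQWker, RingHom.comap_ker,
      lift_eval₂Hom_comp_swapFwd hI𝔓 L, hQ]
  letI : Algebra (MvPolynomial (Fin n) T ⧸ E₂) Lv :=
    ((algebraMap (MvPolynomial (Fin n) D ⧸ ID) Lv).comp e.toRingHom).toAlgebra
  haveI : IsLocalization.AtPrime Lv (Q.map (Ideal.Quotient.mk E₂)) := isLocalization_atPrime_comap_of_ringEquiv e _ _ hQ'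
  exact ⟨(IsLocalization.algEquiv (Q.map (Ideal.Quotient.mk E₂)).primeCompl
    (B ⧸ (E₂).map (algebraMap (MvPolynomial (Fin n) T) B)) Lv).toRingEquiv⟩

/-! ## The regular side `R = S_𝔓 → B` -/

variable [𝔓.IsPrime]

/-- [notation] `Rp = S_𝔓`. -/
local notation3 "Rp" => Localization.AtPrime 𝔓

omit [Q.IsPrime] [𝔓.IsPrime] in
include hQ in
/-- `𝔓 = 𝔔 ∩ S` (the hypothesis of `Localization.localRingHom` for `R → B`). [folklore] -/
theorem prime_eq_comap_ι₂ : 𝔓 = Q.comap ι₂ := by rw [hQ, ker_conePointMap_comap_map hI𝔓 L]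

/-- `𝔪_R · B = E₂ · B` for the structure map `R → B`. [folklore] -/
theorem map_maximalIdeal_regularSide :
    (maximalIdeal Rp).map (Localization.localRingHom 𝔓 Q ι₂ (prime_eq_comap_ι₂ hI𝔓 L hQ)) =
      (E₂).map (algebraMap (MvPolynomial (Fin n) T) B) := by
  have hcomp : (Localization.localRingHom 𝔓 Q ι₂ (prime_eq_comap_ι₂ hI𝔓 L hQ)).comp
      (algebraMap (MvPolynomial (Fin n) K) Rp) = (algebraMap (MvPolynomial (Fin n) T) B).comp ι₂ := by
    refine RingHom.ext fun s => ?_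
    rw [RingHom.comp_apply, RingHom.comp_apply, Localization.localRingHom_to_map]
  rw [← Localization.AtPrime.map_eq_maximalIdeal, Ideal.map_map, hcomp, ← Ideal.map_map]

omit [Q.IsPrime] [IsFractionRing (MvPolynomial (Fin n) K ⧸ 𝔓) L] in
/-- **`𝔪_R` is generated by `h` elements with `h + dim S/𝔓 = n`** (`R = S_𝔓` is a regular local ring of dimension `ht 𝔓`,
and `ht 𝔓 + dim S/𝔓 = n`), and so is `𝔪_R B = E₂ B`. [folklore] -/
theorem exists_span_eq_maximalIdeal_regularSide {d : ℕ} (hd : ringKrullDim (MvPolynomial (Fin n) K ⧸ 𝔓) = d) :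
    ∃ (h : ℕ) (t : Fin h → Rp), h + d = n ∧ Ideal.span (Set.range t) = maximalIdeal Rp := by
  classical
  -- `dim S = n`, `ht 𝔓 = m` with `d + m = n`
  have hS : ringKrullDim (MvPolynomial (Fin n) K) = n := by
    rw [MvPolynomial.ringKrullDim_of_isNoetherianRing, ringKrullDim_eq_zero_of_field, Nat.card_eq_fintype_card,
      Fintype.card_fin, zero_add]
  have hle := Ideal.height_le_ringKrullDim_of_ne_top (Ideal.IsPrime.ne_top ‹𝔓.IsPrime›)
  rw [hS] at hle
  have hle' : 𝔓.height ≤ n := by exact_mod_cast hle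
  obtain ⟨m, hm⟩ := ENat.ne_top_iff_exists.mp (ne_top_of_le_ne_top (ENat.coe_ne_top n) hle')
  have h1 := Literature.RingTheory.KrullDimension.ringKrullDim_quotient_add_height K 𝔓
  rw [hd, ← hm, hS] at h1
  have hdm : d + m = n := by
    have h2 : ((d + m : ℕ) : WithBot ℕ∞) = (n : ℕ) := by push_cast at h1 ⊢; exact h1
    exact_mod_cast h2
  -- `R` is regular of dimension `m`, so `𝔪_R` has `m` generators
  have hdimR : ringKrullDim Rp = m := by
    rw [IsLocalization.AtPrime.ringKrullDim_eq_height 𝔓 Rp, ← hm]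
    rfl
  have hfr : (maximalIdeal Rp).spanFinrank = m := by
    haveI hreg : IsRegularLocalRing (Localization.AtPrime 𝔓) := inferInstance
    have := hreg.spanFinrank_maximalIdeal
    rw [hdimR] at this
    exact_mod_cast this
  obtain ⟨s, hscard, hsspan⟩ := Submodule.FG.exists_span_finset_card_eq_spanFinrank (IsNoetherian.noetherian (maximalIdeal Rp))
  refine ⟨s.card, fun i => (s.equivFin.symm i : Rp), by rw [hscard, hfr]; omega, ?_⟩
  rw [← hsspan]
  congr 1
  ext r
  simp only [Set.mem_range, Finset.mem_coe]
  constructor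
  · rintro ⟨i, rfl⟩; exact (s.equivFin.symm i).2
  · intro hr; exact ⟨s.equivFin ⟨r, hr⟩, by simp⟩

end Structure


end CampaignW42

end Summit.ResolutionOfSingularities.ResolutionOfSingularities.Theorems

end
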